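import Mathlib
import HarnessLib

/-!
# Multiterminal (multiway) cuts: the isolating-cut inequality of Dahlhaus–Johnson–Papadimitriou–Seymour–Yannakakis

Topic `Literature/Combinatorics/SimpleGraph`.  For a graph `G`, a finite set of TERMINALS `T` and nonnegative
edge weights `w`, a **multiterminal cut** (`IsMultiwayCut`) is a set of edges whose removal disconnects every
pair of distinct terminals, and an **isolating cut** for a terminal `t` (`IsIsolatingCut`) is a set of edges whose
removal disconnects `t` from every other terminal [DahlhausEtAl1994, §1 p. 864 and §2].

The key step in the proof of the `2(k-1)/k`-approximation theorem for the Isolation Heuristic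
[DahlhausEtAl1994, §4.4, Thm. 4] reads, as printed: «Let `Ē` be an optimal `k`-terminal cut, and let `w̄ = w(Ē)`.
For `1 ≤ i ≤ k`, let `V_i` be the set of vertices left connected to `s_i` by `Ē`, and let `Ē_i` be the set of edges
in `Ē` with one endpoint in `V_i`.  Note first that for each `i`, the set `Ē_i` is an isolating cut for `s_i`.  Hence
`w(Ē_i) ≥ w(Ê_i)` [`Ê_i` a minimum weight isolating cut].  On the other hand, each edge in `Ē` is in exactly two
different sets `Ē_i`, and so `Σ_{i=1}^k w(Ē_i) = 2w̄`.»

This file proves the step in its inequality form, which needs neither optimality of `Ē` nor positivity of `w`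
(the printed «exactly two» / «`= 2w̄`» use both; the argument uses only «at most two» / «`≤ 2w̄`»):
* `isolatingCutOf G E t` is the printed `Ē_i` (the edges of `E` with an endpoint left connected to `t` by `E`);
* `isolatingCutOf_isIsolatingCut`: for EVERY multiterminal cut `E`, `Ē_t` is an isolating cut for `t`;
* `card_filter_mem_isolatingCutOf_le_two`: each edge of `E` lies in at most two of the `Ē_t`;
* `sum_isolatingCutOf_le_two_mul`: `Σ_{t ∈ T} w(Ē_t) ≤ 2·w(E)`;
* `DahlhausEtAl1994_thm4_step`: the step, packaged as an existence statement;
* `DahlhausEtAl1994_sum_iso_le_two_mul`: consequently, if `iso t` is any lower bound for the weights of the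
  isolating cuts of `t` (e.g. the minimum), then `Σ_{t ∈ T} iso t ≤ 2·w(E)` for every multiterminal cut `E` — in
  particular `Σ_t iso_t ≤ 2·MW` for the minimum multiterminal cut weight `MW`;
* `DahlhausEtAl1994_card_mul_le_two_mul`: a uniform lower bound `m` gives `#T · m ≤ 2·w(E)`.

## References

* E. Dahlhaus, D. S. Johnson, C. H. Papadimitriou, P. D. Seymour, M. Yannakakis, *The complexity of multiterminal
  cuts*, SIAM J. Comput. 23 (1994) 864–894, §4.4, Theorem 4 and its proof [DahlhausEtAl1994].
-/

namespace Literature.Combinatorics.SimpleGraph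

open Finset _root_.SimpleGraph

universe u

variable {V : Type u} [DecidableEq V] (G : _root_.SimpleGraph V)

/-- `C` is a **multiterminal (`k`-terminal, multiway) cut** for the terminal set `T`: after removing the edges of
`C`, no two distinct terminals are connected. [cite: DahlhausEtAl1994, §1 p. 864] -/
def IsMultiwayCut (T : Finset V) (C : Finset (Sym2 V)) : Prop :=
  ∀ t ∈ T, ∀ t' ∈ T, t ≠ t' → ¬ (G.deleteEdges (↑C : Set (Sym2 V))).Reachable t t'

/-- `C` is an **isolating cut** for the terminal `t` (with respect to the terminal set `T`): after removing the
edges of `C`, `t` is connected to no other terminal — «any set of edges that cuts all paths between `s_i` and all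
the other terminals». [cite: DahlhausEtAl1994, §2] -/
def IsIsolatingCut (T : Finset V) (t : V) (C : Finset (Sym2 V)) : Prop :=
  ∀ t' ∈ T, t' ≠ t → ¬ (G.deleteEdges (↑C : Set (Sym2 V))).Reachable t t'

omit [DecidableEq V] in
/-- A multiterminal cut is the same thing as a simultaneous isolating cut for every terminal («a `k`-terminal cut
induces isolating cuts for each of the `k` terminals»). [cite: DahlhausEtAl1994, §2] -/
theorem isMultiwayCut_iff_forall_isIsolatingCut (T : Finset V) (C : Finset (Sym2 V)) :
    IsMultiwayCut G T C ↔ ∀ t ∈ T, IsIsolatingCut G T t C :=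
  ⟨fun h t ht t' ht' hne => h t ht t' ht' hne.symm, fun h t ht t' ht' hne => h t ht t' ht' hne.symm⟩

open Classical in
/-- The printed `Ē_i`: the edges of `E` with (at least) one endpoint in `V_i`, the set of vertices left connected to
the terminal `t` by `E`. [cite: DahlhausEtAl1994, §4.4, proof of Thm. 4] -/
noncomputable def isolatingCutOf (E : Finset (Sym2 V)) (t : V) : Finset (Sym2 V) :=
  E.filter (fun e => ∃ v, v ∈ e ∧ (G.deleteEdges (↑E : Set (Sym2 V))).Reachable t v)

omit [DecidableEq V] in
/-- `Ē_t ⊆ E` («the set of edges in `Ē` with one endpoint in `V_i`»). [cite: DahlhausEtAl1994, §4.4, proof of Thm. 4] -/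
theorem isolatingCutOf_subset (E : Finset (Sym2 V)) (t : V) : isolatingCutOf G E t ⊆ E := by
  classical
  unfold isolatingCutOf
  exact Finset.filter_subset _ _

omit [DecidableEq V] in
/-- Membership in `Ē_t`: an edge of `E` with an endpoint left connected to `t` by `E`.
[cite: DahlhausEtAl1994, §4.4, proof of Thm. 4] -/
theorem mem_isolatingCutOf_iff (E : Finset (Sym2 V)) (t : V) (e : Sym2 V) :
    e ∈ isolatingCutOf G E t ↔ e ∈ E ∧ ∃ v, v ∈ e ∧ (G.deleteEdges (↑E : Set (Sym2 V))).Reachable t v := by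
  classical
  unfold isolatingCutOf
  rw [Finset.mem_filter]

omit [DecidableEq V] in
/-- A set of vertices containing `a` and closed under `K`-adjacency contains every vertex `K`-reachable from `a`
(induction along a walk). [folklore] -/
private theorem mem_of_reachable_of_adj_closed {K : _root_.SimpleGraph V} {S : Set V}
    (hS : ∀ ⦃u v : V⦄, u ∈ S → K.Adj u v → v ∈ S) {a b : V} (ha : a ∈ S) (h : K.Reachable a b) : b ∈ S := by
  obtain ⟨p⟩ := h
  revert ha
  induction p with
  | nil => exact fun h => h
  | cons hadj p ih => exact fun h => ih (hS h hadj)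

/-- «Note first that for each `i`, the set `Ē_i` is an isolating cut for `s_i`.» — valid for every multiterminal
cut `E` (optimality is not used). [cite: DahlhausEtAl1994, §4.4, proof of Thm. 4] -/
theorem isolatingCutOf_isIsolatingCut (T : Finset V) (E : Finset (Sym2 V)) (hE : IsMultiwayCut G T E)
    {t : V} (ht : t ∈ T) : IsIsolatingCut G T t (isolatingCutOf G E t) := by
  classical
  intro t' ht' hne hreach
  -- `V_t` = the vertices left connected to `t` by `E`; it is closed under adjacency in `G − Ē_t`
  have hclosed : ∀ ⦃u v : V⦄, u ∈ {x | (G.deleteEdges (↑E : Set (Sym2 V))).Reachable t x} →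
      (G.deleteEdges (↑(isolatingCutOf G E t) : Set (Sym2 V))).Adj u v →
      v ∈ {x | (G.deleteEdges (↑E : Set (Sym2 V))).Reachable t x} := by
    intro u v hu huv
    rw [SimpleGraph.deleteEdges_adj] at huv
    obtain ⟨hGuv, hnot⟩ := huv
    simp only [Set.mem_setOf_eq] at hu ⊢
    by_cases heE : s(u, v) ∈ E
    · -- an edge of `E` with an endpoint in `V_t` belongs to `Ē_t`, so it is not available
      exfalso
      apply hnot
      rw [Finset.mem_coe, mem_isolatingCutOf_iff]
      exact ⟨heE, u, Sym2.mem_mk_left u v, hu⟩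
    · -- an edge outside `E` keeps us inside `V_t`
      refine hu.trans (SimpleGraph.Adj.reachable ?_)
      rw [SimpleGraph.deleteEdges_adj]
      exact ⟨hGuv, by rwa [Finset.mem_coe]⟩
  have htt' : (G.deleteEdges (↑E : Set (Sym2 V))).Reachable t t' :=
    mem_of_reachable_of_adj_closed hclosed (SimpleGraph.Reachable.refl t) hreach
  exact hE t ht t' ht' hne.symm htt'

/-- «each edge in `Ē` is in [at most] two different sets `Ē_i`»: a vertex is left connected to at most one terminal,
and an edge has two endpoints. [cite: DahlhausEtAl1994, §4.4, proof of Thm. 4] -/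
theorem card_filter_mem_isolatingCutOf_le_two (T : Finset V) (E : Finset (Sym2 V)) (hE : IsMultiwayCut G T E)
    (e : Sym2 V) : (T.filter (fun t => e ∈ isolatingCutOf G E t)).card ≤ 2 := by
  classical
  -- at most one terminal is left connected to a given vertex
  have hone : ∀ v : V,
      (T.filter (fun t => (G.deleteEdges (↑E : Set (Sym2 V))).Reachable t v)).card ≤ 1 := by
    intro v
    rw [Finset.card_le_one]
    intro a ha b hb
    rw [Finset.mem_filter] at ha hb
    by_contra hab
    exact hE a ha.1 b hb.1 hab (ha.2.trans hb.2.symm)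
  revert e
  refine Sym2.ind (fun a b => ?_)
  have hsub : T.filter (fun t => s(a, b) ∈ isolatingCutOf G E t) ⊆
      T.filter (fun t => (G.deleteEdges (↑E : Set (Sym2 V))).Reachable t a) ∪
        T.filter (fun t => (G.deleteEdges (↑E : Set (Sym2 V))).Reachable t b) := by
    intro t ht
    rw [Finset.mem_filter] at ht
    obtain ⟨htT, hmem⟩ := ht
    rw [mem_isolatingCutOf_iff] at hmem
    obtain ⟨_, v, hv, hreach⟩ := hmem
    rw [Sym2.mem_iff] at hv
    rw [Finset.mem_union, Finset.mem_filter, Finset.mem_filter]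
    rcases hv with rfl | rfl
    · exact Or.inl ⟨htT, hreach⟩
    · exact Or.inr ⟨htT, hreach⟩
  calc (T.filter (fun t => s(a, b) ∈ isolatingCutOf G E t)).card
      ≤ (T.filter (fun t => (G.deleteEdges (↑E : Set (Sym2 V))).Reachable t a) ∪
          T.filter (fun t => (G.deleteEdges (↑E : Set (Sym2 V))).Reachable t b)).card :=
        Finset.card_le_card hsub
    _ ≤ (T.filter (fun t => (G.deleteEdges (↑E : Set (Sym2 V))).Reachable t a)).card +
          (T.filter (fun t => (G.deleteEdges (↑E : Set (Sym2 V))).Reachable t b)).card :=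
        Finset.card_union_le _ _
    _ ≤ 1 + 1 := Nat.add_le_add (hone a) (hone b)

/-- «… and so `Σ_{i=1}^k w(Ē_i) ≤ 2w̄`» — the print has `=` (positive weights, `Ē` optimal); `≤` needs only `w ≥ 0`.
[cite: DahlhausEtAl1994, §4.4, proof of Thm. 4] -/
theorem sum_isolatingCutOf_le_two_mul (T : Finset V) (E : Finset (Sym2 V)) (hE : IsMultiwayCut G T E)
    (w : Sym2 V → ℝ) (hw : ∀ e, 0 ≤ w e) :
    ∑ t ∈ T, ∑ e ∈ isolatingCutOf G E t, w e ≤ 2 * ∑ e ∈ E, w e := by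
  classical
  have hft : ∀ t, E.filter (fun e => e ∈ isolatingCutOf G E t) = isolatingCutOf G E t := fun t => by
    rw [Finset.filter_mem_eq_inter, Finset.inter_eq_right.mpr (isolatingCutOf_subset G E t)]
  calc ∑ t ∈ T, ∑ e ∈ isolatingCutOf G E t, w e
      = ∑ t ∈ T, ∑ e ∈ E, (if e ∈ isolatingCutOf G E t then w e else 0) := by
        refine Finset.sum_congr rfl (fun t _ => ?_)
        rw [← Finset.sum_filter, hft t]
    _ = ∑ e ∈ E, ∑ t ∈ T, (if e ∈ isolatingCutOf G E t then w e else 0) := Finset.sum_comm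
    _ ≤ ∑ e ∈ E, 2 * w e := by
        refine Finset.sum_le_sum (fun e _ => ?_)
        rw [← Finset.sum_filter, Finset.sum_const, nsmul_eq_mul]
        have h2 : ((T.filter (fun t => e ∈ isolatingCutOf G E t)).card : ℝ) ≤ 2 := by
          exact_mod_cast card_filter_mem_isolatingCutOf_le_two G T E hE e
        exact mul_le_mul_of_nonneg_right h2 (hw e)
    _ = 2 * ∑ e ∈ E, w e := by rw [Finset.mul_sum]

/-- **The printed step, packaged** [DahlhausEtAl1994, §4.4, proof of Thm. 4]: every multiterminal cut `E` induces
isolating cuts `Ē_t ⊆ E`, one per terminal, of total weight at most `2·w(E)` (weights `w ≥ 0`).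
[cite: DahlhausEtAl1994, §4.4, Thm. 4 (proof)] -/
theorem DahlhausEtAl1994_thm4_step (T : Finset V) (E : Finset (Sym2 V)) (hE : IsMultiwayCut G T E)
    (w : Sym2 V → ℝ) (hw : ∀ e, 0 ≤ w e) :
    ∃ F : V → Finset (Sym2 V), (∀ t ∈ T, F t ⊆ E ∧ IsIsolatingCut G T t (F t)) ∧
      ∑ t ∈ T, ∑ e ∈ F t, w e ≤ 2 * ∑ e ∈ E, w e :=
  ⟨isolatingCutOf G E, fun _ ht => ⟨isolatingCutOf_subset G E _, isolatingCutOf_isIsolatingCut G T E hE ht⟩,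
    sum_isolatingCutOf_le_two_mul G T E hE w hw⟩

/-- **Sum of minimum isolating cuts ≤ twice any multiterminal cut**: if `iso t` is a lower bound for the weight of
every isolating cut of `t` (e.g. the minimum weight `w(Ê_t)` of the print), then `Σ_{t ∈ T} iso t ≤ 2·w(E)` for
EVERY multiterminal cut `E` — in particular for a minimum one. [cite: DahlhausEtAl1994, §4.4, Thm. 4 (proof)] -/
theorem DahlhausEtAl1994_sum_iso_le_two_mul (T : Finset V) (w : Sym2 V → ℝ) (hw : ∀ e, 0 ≤ w e) (iso : V → ℝ)
    (hiso : ∀ t ∈ T, ∀ C : Finset (Sym2 V), IsIsolatingCut G T t C → iso t ≤ ∑ e ∈ C, w e)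
    (E : Finset (Sym2 V)) (hE : IsMultiwayCut G T E) :
    ∑ t ∈ T, iso t ≤ 2 * ∑ e ∈ E, w e :=
  (Finset.sum_le_sum fun t ht => hiso t ht _ (isolatingCutOf_isIsolatingCut G T E hE ht)).trans
    (sum_isolatingCutOf_le_two_mul G T E hE w hw)

/-- A uniform lower bound `m` of all isolating-cut weights of all terminals gives `#T · m ≤ 2·w(E)` for every
multiterminal cut `E` (so a minimum multiterminal cut weighs at least `(k/2)·m`, `k = #T`).
[cite: DahlhausEtAl1994, §4.4, Thm. 4 (proof)] -/
theorem DahlhausEtAl1994_card_mul_le_two_mul (T : Finset V) (w : Sym2 V → ℝ) (hw : ∀ e, 0 ≤ w e) (m : ℝ)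
    (hm : ∀ t ∈ T, ∀ C : Finset (Sym2 V), IsIsolatingCut G T t C → m ≤ ∑ e ∈ C, w e)
    (E : Finset (Sym2 V)) (hE : IsMultiwayCut G T E) :
    (T.card : ℝ) * m ≤ 2 * ∑ e ∈ E, w e := by
  have h := DahlhausEtAl1994_sum_iso_le_two_mul G T w hw (fun _ => m) hm E hE
  simpa [Finset.sum_const, nsmul_eq_mul] using h

/-! ### The rest of the printed upper-bound argument of Theorem 4

«Note that the Isolation Heuristic clearly outputs a `k`-terminal cut» and «Thus `w(Ê) ≤ ((k−1)/k) Σ w(Ê_i) ≤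
((k−1)/k) Σ w(Ē_i) = 2((k−1)/k) w̄` as claimed» [DahlhausEtAl1994, §4.4, Thm. 4 and its proof]. -/

omit [DecidableEq V] in
/-- Isolating cuts are monotone: a superset of an isolating cut is an isolating cut. [cite: DahlhausEtAl1994, §2] -/
theorem IsIsolatingCut.mono {T : Finset V} {t : V} {C C' : Finset (Sym2 V)} (hC : IsIsolatingCut G T t C)
    (hCC' : C ⊆ C') : IsIsolatingCut G T t C' := by
  intro t' ht' hne hreach
  refine hC t' ht' hne (hreach.mono ?_)
  exact SimpleGraph.deleteEdges_anti (Finset.coe_subset.mpr hCC')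

/-- «Note that the Isolation Heuristic clearly outputs a `k`-terminal cut»: the union of isolating cuts of all
terminals but one is a multiterminal cut. [cite: DahlhausEtAl1994, §4.4, Thm. 4 (proof)] -/
theorem isMultiwayCut_biUnion_erase {T : Finset V} (F : V → Finset (Sym2 V))
    (hF : ∀ t ∈ T, IsIsolatingCut G T t (F t)) (h : V) :
    IsMultiwayCut G T ((T.erase h).biUnion F) := by
  intro t ht t' ht' hne
  by_cases hth : t = h
  · -- then `t' ≠ h`: use the isolating cut of `t'` and the symmetry of reachability
    have ht'h : t' ≠ h := fun e => hne (hth.trans e.symm)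
    have hsub : F t' ⊆ (T.erase h).biUnion F :=
      Finset.subset_biUnion_of_mem F (Finset.mem_erase.mpr ⟨ht'h, ht'⟩)
    intro hreach
    exact (hF t' ht').mono G hsub t ht hne hreach.symm
  · have hsub : F t ⊆ (T.erase h).biUnion F :=
      Finset.subset_biUnion_of_mem F (Finset.mem_erase.mpr ⟨hth, ht⟩)
    exact (hF t ht).mono G hsub t' ht' (fun e => hne e.symm)

omit [DecidableEq V] in
/-- Dropping a largest of the `k = #T` numbers `a t` leaves at most `(k−1)/k` of their sum:
`k · Σ_{t ≠ h} a t ≤ (k − 1) · Σ_t a t`. [folklore] -/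
private theorem card_mul_sum_erase_le [DecidableEq V] {T : Finset V} (a : V → ℝ) {h : V} (hh : h ∈ T)
    (hmax : ∀ t ∈ T, a t ≤ a h) :
    (T.card : ℝ) * ∑ t ∈ T.erase h, a t ≤ ((T.card : ℝ) - 1) * ∑ t ∈ T, a t := by
  have hsum : ∑ t ∈ T, a t ≤ (T.card : ℝ) * a h := by
    calc ∑ t ∈ T, a t ≤ ∑ _t ∈ T, a h := Finset.sum_le_sum hmax
      _ = (T.card : ℝ) * a h := by rw [Finset.sum_const, nsmul_eq_mul]
  have hsplit : ∑ t ∈ T, a t = a h + ∑ t ∈ T.erase h, a t := by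
    rw [← Finset.add_sum_erase T a hh]
  rw [hsplit] at hsum ⊢
  nlinarith [hsum]

/-- The weight of a union is at most the sum of the weights (`w ≥ 0`). [folklore] -/
private theorem sum_biUnion_le_sum_sum (S : Finset V) (F : V → Finset (Sym2 V)) (w : Sym2 V → ℝ)
    (hw : ∀ e, 0 ≤ w e) : ∑ e ∈ S.biUnion F, w e ≤ ∑ t ∈ S, ∑ e ∈ F t, w e := by
  classical
  induction S using Finset.induction_on with
  | empty => simp
  | insert a S ha ih =>
    rw [Finset.biUnion_insert, Finset.sum_insert ha]
    have hui := Finset.sum_union_inter (s₁ := F a) (s₂ := S.biUnion F) (f := w)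
    have hnn : 0 ≤ ∑ e ∈ F a ∩ S.biUnion F, w e := Finset.sum_nonneg (fun e _ => hw e)
    linarith [ih, hui, hnn]

/-- **[DahlhausEtAl1994, Thm. 4], upper bound, as printed** («The Isolation Heuristic constructs a `k`-terminal cut
whose weight is guaranteed to be no more than `2(k − 1)/k` times the optimal weight»), stated against an ARBITRARY
multiterminal cut `E` (equivalently: the optimal one).  If `Ê_t` (`t ∈ T`) are minimum-weight isolating cuts, `h ∈ T`
has `w(Ê_h)` maximal and `Ê := ⋃_{t ≠ h} Ê_t` (steps 1–3 of the heuristic), then `Ê` is a multiterminal cut and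
`k · w(Ê) ≤ 2 (k − 1) · w(E)`, `k = #T` — i.e. `w(Ê) ≤ (2 − 2/k) · w(E)` for weights `w ≥ 0`.
[cite: DahlhausEtAl1994, §4.4, Thm. 4] -/
theorem DahlhausEtAl1994_thm4_upper {T : Finset V} (w : Sym2 V → ℝ) (hw : ∀ e, 0 ≤ w e)
    (Ehat : V → Finset (Sym2 V)) (hiso : ∀ t ∈ T, IsIsolatingCut G T t (Ehat t))
    (hmin : ∀ t ∈ T, ∀ C : Finset (Sym2 V), IsIsolatingCut G T t C → ∑ e ∈ Ehat t, w e ≤ ∑ e ∈ C, w e)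
    {h : V} (hh : h ∈ T) (hmax : ∀ t ∈ T, ∑ e ∈ Ehat t, w e ≤ ∑ e ∈ Ehat h, w e)
    (E : Finset (Sym2 V)) (hE : IsMultiwayCut G T E) :
    IsMultiwayCut G T ((T.erase h).biUnion Ehat) ∧
      (T.card : ℝ) * ∑ e ∈ (T.erase h).biUnion Ehat, w e ≤ 2 * ((T.card : ℝ) - 1) * ∑ e ∈ E, w e := by
  classical
  refine ⟨isMultiwayCut_biUnion_erase G Ehat hiso h, ?_⟩
  -- (1) weight of a union ≤ sum of weights (w ≥ 0)
  have hU : ∑ e ∈ (T.erase h).biUnion Ehat, w e ≤ ∑ t ∈ T.erase h, ∑ e ∈ Ehat t, w e :=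
    sum_biUnion_le_sum_sum (T.erase h) Ehat w hw
  -- (2) drop the heaviest: k Σ_{t ≠ h} ≤ (k-1) Σ_t
  have hdrop := card_mul_sum_erase_le (T := T) (fun t => ∑ e ∈ Ehat t, w e) hh hmax
  -- (3) Σ_t w(Ê_t) ≤ 2 w(E): the isolating-cut inequality above
  have hstep := DahlhausEtAl1994_sum_iso_le_two_mul G T w hw (fun t => ∑ e ∈ Ehat t, w e) hmin E hE
  have hk : (0 : ℝ) ≤ T.card := by positivity
  have hk1 : (0 : ℝ) ≤ (T.card : ℝ) - 1 := by
    have h1 : 1 ≤ T.card := Finset.card_pos.mpr ⟨h, hh⟩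
    have h1' : (1 : ℝ) ≤ T.card := by exact_mod_cast h1
    linarith
  calc (T.card : ℝ) * ∑ e ∈ (T.erase h).biUnion Ehat, w e
      ≤ (T.card : ℝ) * ∑ t ∈ T.erase h, ∑ e ∈ Ehat t, w e := mul_le_mul_of_nonneg_left hU hk
    _ ≤ ((T.card : ℝ) - 1) * ∑ t ∈ T, ∑ e ∈ Ehat t, w e := hdrop
    _ ≤ ((T.card : ℝ) - 1) * (2 * ∑ e ∈ E, w e) := mul_le_mul_of_nonneg_left hstep hk1
    _ = 2 * ((T.card : ℝ) - 1) * ∑ e ∈ E, w e := by ring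

end Literature.Combinatorics.SimpleGraph
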